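import Summits.Ventures.PercRepro.ProfileGapMonoThresholdTopLongFlat

/-!
# PercRepro — THE TOP THRESHOLD CLIMBS THROUGH COLOOPS AND LOOPS (p5, gen 30; `proofs/P5-GM1.md` §41(k);
announced INBOX 13953)

`(I_t)` is vacuous for `t ≥ ρ(E)` (`thresholdIneq_of_rk_le`: no rank-`(q−1)` set has a complement of rank
`≥ t + 1`).  Hence at a coloop `z` the reduction `thresholdIneq_of_coloop` needs nothing at co-rank `q − 1` when `t`
is the top threshold of `N`: **`thresholdIneq_top_of_coloop`** — `(I_{ρ(E∖z)−1})(N ∖ z)`, the top threshold of the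
deletion, gives `(I_{ρ(E)−1})(N)`; and a loop is deleted at the same threshold (`thresholdIneq_top_of_loop`).  So the
top-threshold theorems of ProfileGapMonoThresholdTopLongFlat propagate from the coloop-free, loopless core of a
matroid to the matroid itself, as long as the core keeps its long flat (the flat-tracking through the deletions is the
successor's step).  Nothing open is asserted.
-/

open scoped Matroid

namespace PercRepro.Cogirth

open Finset ThmH Skew Shadow Profile

variable {α : Type} [DecidableEq α] {N : Matroid α} [N.Finite] {q t : ℕ}

/-- **`(I_t)` is vacuous at and above the rank**: for `ρ(E) ≤ t` no rank-`(q−1)` set has a complement of rank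
`≥ t + 1`, so the threshold sum is `0`. -/
theorem thresholdIneq_of_rk_le (h : rk N (gr N) ≤ t) : ThresholdIneq N q t := by
  unfold ThresholdIneq thresholdSum
  have hzero : ∀ B ∈ Rq N (q - 1), (if t + 1 ≤ rk N (gr N \ B) then rk N (gr N \ B) else 0) = 0 := by
    intro B _
    rw [if_neg]
    have := rk_mono' (M := N) (sdiff_subset : gr N \ B ⊆ gr N)
    omega
  rw [sum_congr rfl hzero, sum_const_zero]
  exact Nat.zero_le _

/-- The rank of the deletion of a coloop is one less. -/
theorem rk_gr_delete_of_coloop {z : α} (hzc : rk N ((gr N).erase z) + 1 = rk N (gr N)) :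
    rk (N ＼ ({z} : Set α)) (gr (N ＼ ({z} : Set α))) + 1 = rk N (gr N) := by
  rw [gr_delete', rk_delete (Subset.refl _)]
  exact hzc

/-- **THE TOP THRESHOLD CLIMBS THROUGH A COLOOP** (`2 ≤ q`, `2 ≤ ρ(E)`): the top threshold of `N ∖ z` gives the top
threshold of `N` — the co-rank-`(q−1)` input of `thresholdIneq_of_coloop` is vacuous at the top. -/
theorem thresholdIneq_top_of_coloop {z : α} (hz : z ∈ gr N) (hzc : rk N ((gr N).erase z) + 1 = rk N (gr N))
    (hq : 2 ≤ q) (hR : 2 ≤ rk N (gr N))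
    (h : ThresholdIneq (N ＼ ({z} : Set α)) q (rk (N ＼ ({z} : Set α)) (gr (N ＼ ({z} : Set α))) - 1)) :
    ThresholdIneq N q (rk N (gr N) - 1) := by
  have hrk := rk_gr_delete_of_coloop hzc
  have h1 : ThresholdIneq (N ＼ ({z} : Set α)) q (rk N (gr N) - 1 - 1) := by
    have : rk N (gr N) - 1 - 1 = rk (N ＼ ({z} : Set α)) (gr (N ＼ ({z} : Set α))) - 1 := by omega
    rw [this]
    exact h
  have h2 : ThresholdIneq (N ＼ ({z} : Set α)) (q - 1) (rk N (gr N) - 1) :=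
    thresholdIneq_of_rk_le (by omega)
  exact thresholdIneq_of_coloop hz hzc hq (by omega) h1 h2

/-- **A loop is deleted at the same threshold**; the rank is unchanged. -/
theorem thresholdIneq_top_of_loop {ℓ : α} (hℓ : ℓ ∈ gr N) (h0 : rk N {ℓ} = 0)
    (h : ThresholdIneq (N ＼ ({ℓ} : Set α)) q (rk N (gr N) - 1)) : ThresholdIneq N q (rk N (gr N) - 1) :=
  thresholdIneq_of_loop hℓ h0 h

end PercRepro.Cogirth
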